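import Literature.NumberTheory.Automorphic.LevelTwoInteriorOrbitalTransport      -- ★ p846692 N3 (this seat): the transport with `hZ′`; all §0–§2 helpers
import Literature.NumberTheory.Automorphic.LevelTwoInteriorOrbitalUnfolding      -- ★ (F0P3-p04): `centralizer_eq_of_coe_eq_moebius`, `isUnit_sq_sub_sq_of_apply_eq_toPlace_uniformizer`
import HarnessLib

/-!
# Level-two interior orbital transport — the `hF` socket without the second compactness witness

[cite: Rogawski1990, §4.9 Prop. 4.9.1 p. 55; §4.3 (4.3.1) p. 43] [cite: Kottwitz1986, §3]

★ `classOrbitalIntegral_levelOneIndicator_eq_shift` (N3) carries two compactness hypotheses: `hZ` (every class matching `γ_H` has compact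
centraliser) and `hZ′` (the same for `u_H = φ_c(γ_H)`).  The second is idle: the proof only needs it at the shifted class `y = φ_c(x)` of a class
`x` matching `γ_H`, and there `Z(y) = Z(x)` because a matrix commutes with `x` iff it commutes with `((c+1)x + (c−1))((c−1)x + (c+1))⁻¹`
(★ `centralizer_eq_of_coe_eq_moebius`, `4c = (c+1)² − (c−1)²` a unit at the non-split place).  This file records the `hZ′`-free edition
`classOrbitalIntegral_levelOneIndicator_eq_shift_of_compact`, proof verbatim that of N3 with the one line replaced.

**Main result.** `classOrbitalIntegral_levelOneIndicator_eq_shift_of_compact`.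
-/

set_option autoImplicit false

noncomputable section

open NumberField IsDedekindDomain Matrix Polynomial MeasureTheory Measure Topology Filter
open scoped MatrixGroups WithZero Valued

namespace Literature.NumberTheory.Automorphic

open UnitaryGroup Literature.NumberTheory.Rogawski1990 Literature.NumberTheory.Automorphic.MoebiusShift Literature.NumberTheory.Automorphic.IntegralReduction
  Literature.NumberTheory.Automorphic.UnitaryLatticeTree Literature.NumberTheory.GaloisRepresentations Literature.NumberTheory.NumberFields

set_option maxHeartbeats 1600000 in
-- budget only: the statement carries the END fold's CM-place tokens (★ N2 ∕ ★ (U) precedent); no search tactic runs long here.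
/-- **N3′ «THE `hF` SOCKET WITHOUT `hZ′`»** — the level-two interior orbital transport ★ `classOrbitalIntegral_levelOneIndicator_eq_shift`
with the compactness hypothesis on the centralisers of the classes matching `u_H = φ_c(γ_H)` REMOVED: for the one class `⟦y⟧`, `y = φ_c(x)`, that the
identity is about, `Z(y) = Z(x)` (★ `centralizer_eq_of_coe_eq_moebius`: a matrix commutes with `x` iff it commutes with its Cayley shift), so the
compactness of `Z(x)` (hypothesis `hZ`, the ¬LEVI input on the `γ_H` side) is all that is used.  Same conclusion:
`Φ(⟦x⟧, 1_{x_w ≡ 1 (ϖ)}·g) = Φ(⟦y⟧, g′)`.  This is the form the END fold's `stub_liftInterior` socket consumes (the type-(1)∕(2) branch heads hand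
`hD1 hD2 uH hreg' h1 h2'` and the matching class, never a second compactness witness). [cite: Rogawski1990, §4.9 Prop. 4.9.1 p. 55; §4.3 (4.3.1) p. 43]
[cite: Kottwitz1986, §3] -/
theorem classOrbitalIntegral_levelOneIndicator_eq_shift_of_compact (L : Type) [Field L] [NumberField L] [IsCMField L] (H' : Matrix (Fin 3) (Fin 3) L)
    {v : HeightOneSpectrum (𝓞 ↥(maximalRealSubfield L))}
    (hH' : (H'.map (cmConjRingHom L)).transpose = H') (hdet : H'.det ≠ 0) (w : UnitaryGroup.PlacesOver L v)
    (hw : IsCMField.complexConj L • w.1 = w.1) (hv : Algebra.IsUnramifiedIn (𝓞 L) v.asIdeal)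
    (h2 : Valued.v (2 : w.1.adicCompletion L) = 1)
    [MeasurableSpace ((cmDatum L 3 H').Local v)] [BorelSpace ((cmDatum L 3 H').Local v)]
    [∀ γ : ((cmDatum L 3 H').Local v), MeasurableSpace (((cmDatum L 3 H').Local v) ⧸ Subgroup.centralizer ({γ} : Set ((cmDatum L 3 H').Local v)))]
    [∀ γ : ((cmDatum L 3 H').Local v), BorelSpace (((cmDatum L 3 H').Local v) ⧸ Subgroup.centralizer ({γ} : Set ((cmDatum L 3 H').Local v)))]
    (νG : Measure ((cmDatum L 3 H').Local v)) [νG.IsHaarMeasure] [νG.IsMulRightInvariant] {mG : OrbitalMeasureFamily ((cmDatum L 3 H').Local v)}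
    (hmG : mG.IsCanonical (fun γ => IsRegularElt (γ.val : GL (Fin 3) (UnitaryGroup.LocalRing L v))) νG)
    (c : LocalRing L v)
    (hcw : c w = toPlace v w (HeckeCharacter.uniformizer ↥(maximalRealSubfield L) v : v.adicCompletion ↥(maximalRealSubfield L)))
    (γH uH : (cmDatum L 2 (Matrix.of fun i j : Fin 2 => if i.val + j.val + 1 = 2 then (1 : L) else 0)).Local v ×
      (cmDatum L 1 (Matrix.of fun i j : Fin 1 => if i.val + j.val + 1 = 1 then (1 : L) else 0)).Local v)
    (hreg : IsLocalGRegular L v γH) (hreg' : IsLocalGRegular L v uH)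
    (h1 : ((uH.1.val : GL (Fin 2) (LocalRing L v)).val : Matrix (Fin 2) (Fin 2) (LocalRing L v)) =
      ((c + 1) • ((γH.1.val : GL (Fin 2) (LocalRing L v)).val : Matrix (Fin 2) (Fin 2) (LocalRing L v)) + (c - 1) • 1) *
        ((c - 1) • ((γH.1.val : GL (Fin 2) (LocalRing L v)).val : Matrix (Fin 2) (Fin 2) (LocalRing L v)) + (c + 1) • 1)⁻¹)
    (h2' : ((uH.2.val : GL (Fin 1) (LocalRing L v)).val : Matrix (Fin 1) (Fin 1) (LocalRing L v)) =
      ((c + 1) • ((γH.2.val : GL (Fin 1) (LocalRing L v)).val : Matrix (Fin 1) (Fin 1) (LocalRing L v)) + (c - 1) • 1) *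
        ((c - 1) • ((γH.2.val : GL (Fin 1) (LocalRing L v)).val : Matrix (Fin 1) (Fin 1) (LocalRing L v)) + (c + 1) • 1)⁻¹)
    (hD1 : IsUnit ((c - 1) • ((γH.1.val : GL (Fin 2) (LocalRing L v)).val : Matrix (Fin 2) (Fin 2) (LocalRing L v)) + (c + 1) • (1 : Matrix (Fin 2) (Fin 2) (LocalRing L v))).det)
    (hD2 : IsUnit ((c - 1) • ((γH.2.val : GL (Fin 1) (LocalRing L v)).val : Matrix (Fin 1) (Fin 1) (LocalRing L v)) + (c + 1) • (1 : Matrix (Fin 1) (Fin 1) (LocalRing L v))).det)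
    (hdeep : ∀ i j, Valued.v (((((endoEmbLocal L v γH).val : GL (Fin 3) (LocalRing L v)).val.map
        (Pi.evalRingHom (fun w' : UnitaryGroup.PlacesOver L v => w'.1.adicCompletion L) w)) - 1) i j) ≤ Valued.v (c w) ^ 2)
    (hZ : ∀ x : (cmDatum L 3 H').Local v, IsLocalNormPair L H' v γH x → CompactSpace (Subgroup.centralizer ({x} : Set ((cmDatum L 3 H').Local v))))
    (g : ((cmDatum L 3 H').Local v) → ℂ) (hg : Rogawski1990.IsLocSmooth g) (hgK : tsupport g ⊆ (cmLocalIntegralLevel L 3 H' v : Set ((cmDatum L 3 H').Local v)))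
    (hginv : ∀ u ∈ cmLocalIntegralLevel L 3 H' v, ∀ x, g (u * x * u⁻¹) = g x)
    (c' : ℕ → ℂ) (hc' : ((∀ x : ((cmDatum L 3 H').Local v), (x ∈ cmLocalIntegralLevel L 3 H' v ∧ (∀ a b, Valued.v (((toPlace v w (HeckeCharacter.uniformizer ↥(maximalRealSubfield L) v : v.adicCompletion ↥(maximalRealSubfield L))) ^ 1)⁻¹ *
        ((((localNonsplitEquiv (IsCMField.complexConj L) H' (IsCMField.complexConj_ne_one L) w hw (x) :
            ↥(unitaryGroupOfForm (galAdicCompletionMap (L := L) (IsCMField.complexConj L) hw) (placeForm H' w.1))) : GL (Fin 3) (w.1.adicCompletion L)) :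
              Matrix (Fin 3) (Fin 3) (w.1.adicCompletion L)) a b - (1 : Matrix (Fin 3) (Fin 3) (w.1.adicCompletion L)) a b)) ≤ 1) ∧
        (redMat ((toPlace v w (HeckeCharacter.uniformizer ↥(maximalRealSubfield L) v : v.adicCompletion ↥(maximalRealSubfield L)))⁻¹ • ((((x).val : GL (Fin 3) (UnitaryGroup.LocalRing L v)).val.map (Pi.evalRingHom (fun w' : UnitaryGroup.PlacesOver L v => w'.1.adicCompletion L) w)) - 1))) ^ 3 = 0 ∧ (redMat ((toPlace v w (HeckeCharacter.uniformizer ↥(maximalRealSubfield L) v : v.adicCompletion ↥(maximalRealSubfield L)))⁻¹ • ((((x).val : GL (Fin 3) (UnitaryGroup.LocalRing L v)).val.map (Pi.evalRingHom (fun w' : UnitaryGroup.PlacesOver L v => w'.1.adicCompletion L) w)) - 1))).rank = 0) → g x = c' 0) ∧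
      (∀ x : ((cmDatum L 3 H').Local v), (x ∈ cmLocalIntegralLevel L 3 H' v ∧ (∀ a b, Valued.v (((toPlace v w (HeckeCharacter.uniformizer ↥(maximalRealSubfield L) v : v.adicCompletion ↥(maximalRealSubfield L))) ^ 1)⁻¹ *
        ((((localNonsplitEquiv (IsCMField.complexConj L) H' (IsCMField.complexConj_ne_one L) w hw (x) :
            ↥(unitaryGroupOfForm (galAdicCompletionMap (L := L) (IsCMField.complexConj L) hw) (placeForm H' w.1))) : GL (Fin 3) (w.1.adicCompletion L)) :
              Matrix (Fin 3) (Fin 3) (w.1.adicCompletion L)) a b - (1 : Matrix (Fin 3) (Fin 3) (w.1.adicCompletion L)) a b)) ≤ 1) ∧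
        (redMat ((toPlace v w (HeckeCharacter.uniformizer ↥(maximalRealSubfield L) v : v.adicCompletion ↥(maximalRealSubfield L)))⁻¹ • ((((x).val : GL (Fin 3) (UnitaryGroup.LocalRing L v)).val.map (Pi.evalRingHom (fun w' : UnitaryGroup.PlacesOver L v => w'.1.adicCompletion L) w)) - 1))) ^ 3 = 0 ∧ (redMat ((toPlace v w (HeckeCharacter.uniformizer ↥(maximalRealSubfield L) v : v.adicCompletion ↥(maximalRealSubfield L)))⁻¹ • ((((x).val : GL (Fin 3) (UnitaryGroup.LocalRing L v)).val.map (Pi.evalRingHom (fun w' : UnitaryGroup.PlacesOver L v => w'.1.adicCompletion L) w)) - 1))).rank = 1) → g x = c' 1) ∧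
      (∀ x : ((cmDatum L 3 H').Local v), (x ∈ cmLocalIntegralLevel L 3 H' v ∧ (∀ a b, Valued.v (((toPlace v w (HeckeCharacter.uniformizer ↥(maximalRealSubfield L) v : v.adicCompletion ↥(maximalRealSubfield L))) ^ 1)⁻¹ *
        ((((localNonsplitEquiv (IsCMField.complexConj L) H' (IsCMField.complexConj_ne_one L) w hw (x) :
            ↥(unitaryGroupOfForm (galAdicCompletionMap (L := L) (IsCMField.complexConj L) hw) (placeForm H' w.1))) : GL (Fin 3) (w.1.adicCompletion L)) :
              Matrix (Fin 3) (Fin 3) (w.1.adicCompletion L)) a b - (1 : Matrix (Fin 3) (Fin 3) (w.1.adicCompletion L)) a b)) ≤ 1) ∧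
        (redMat ((toPlace v w (HeckeCharacter.uniformizer ↥(maximalRealSubfield L) v : v.adicCompletion ↥(maximalRealSubfield L)))⁻¹ • ((((x).val : GL (Fin 3) (UnitaryGroup.LocalRing L v)).val.map (Pi.evalRingHom (fun w' : UnitaryGroup.PlacesOver L v => w'.1.adicCompletion L) w)) - 1))) ^ 3 = 0 ∧ (redMat ((toPlace v w (HeckeCharacter.uniformizer ↥(maximalRealSubfield L) v : v.adicCompletion ↥(maximalRealSubfield L)))⁻¹ • ((((x).val : GL (Fin 3) (UnitaryGroup.LocalRing L v)).val.map (Pi.evalRingHom (fun w' : UnitaryGroup.PlacesOver L v => w'.1.adicCompletion L) w)) - 1))).rank = 2) → g x = c' 2)))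
    (g' : ((cmDatum L 3 H').Local v) → ℂ) (hg' : Rogawski1990.IsLocSmooth g') (hg'K : tsupport g' ⊆ (cmLocalIntegralLevel L 3 H' v : Set ((cmDatum L 3 H').Local v)))
    (hg'inv : ∀ u ∈ cmLocalIntegralLevel L 3 H' v, ∀ x, g' (u * x * u⁻¹) = g' x)
    (hg'val : ∀ k ∈ cmLocalIntegralLevel L 3 H' v,
        (redMat (((k).val : GL (Fin 3) (UnitaryGroup.LocalRing L v)).val.map (Pi.evalRingHom (fun w' : UnitaryGroup.PlacesOver L v => w'.1.adicCompletion L) w)) - 1) ^ 3 = 0 →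
        g' k = c' (redMat (((k).val : GL (Fin 3) (UnitaryGroup.LocalRing L v)).val.map (Pi.evalRingHom (fun w' : UnitaryGroup.PlacesOver L v => w'.1.adicCompletion L) w)) - 1).rank)
    (x y : (cmDatum L 3 H').Local v) (hx : IsLocalNormPair L H' v γH x)
    (hy : ((y.val : GL (Fin 3) (LocalRing L v)).val : Matrix (Fin 3) (Fin 3) (LocalRing L v)) =
      ((c + 1) • ((x.val : GL (Fin 3) (LocalRing L v)).val : Matrix (Fin 3) (Fin 3) (LocalRing L v)) + (c - 1) • 1) *
        ((c - 1) • ((x.val : GL (Fin 3) (LocalRing L v)).val : Matrix (Fin 3) (Fin 3) (LocalRing L v)) + (c + 1) • 1)⁻¹) :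
    classOrbitalIntegral mG ({x : (cmDatum L 3 H').Local v | (∀ a b, Valued.v (((toPlace v w (HeckeCharacter.uniformizer ↥(maximalRealSubfield L) v : v.adicCompletion ↥(maximalRealSubfield L))) ^ 1)⁻¹ *
        ((((localNonsplitEquiv (IsCMField.complexConj L) H' (IsCMField.complexConj_ne_one L) w hw (x) :
            ↥(unitaryGroupOfForm (galAdicCompletionMap (L := L) (IsCMField.complexConj L) hw) (placeForm H' w.1))) : GL (Fin 3) (w.1.adicCompletion L)) :
              Matrix (Fin 3) (Fin 3) (w.1.adicCompletion L)) a b - (1 : Matrix (Fin 3) (Fin 3) (w.1.adicCompletion L)) a b)) ≤ 1)}.indicator g) (ConjClasses.mk x) =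
      classOrbitalIntegral mG g' (ConjClasses.mk y) := by
  classical
  -- §0 the place: one `w` above `v`, the model `e`, `c_w = ϖ_v`
  have hsub : Subsingleton (UnitaryGroup.PlacesOver L v) := PlacesOver.subsingleton_of_smul_eq (IsCMField.complexConj L) (IsCMField.complexConj_ne_one L) w hw
  set evw : LocalRing L v →+* w.1.adicCompletion L := (Pi.evalRingHom (fun w' : UnitaryGroup.PlacesOver L v => w'.1.adicCompletion L) w) with hevw
  set ϖ' : w.1.adicCompletion L := (toPlace v w (HeckeCharacter.uniformizer ↥(maximalRealSubfield L) v : v.adicCompletion ↥(maximalRealSubfield L))) with hϖ'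
  have hϖv : Valued.v ϖ' = WithZero.exp (-1 : ℤ) := Liu2021.LemD1IndexedNonVacuityInertCofinite.valued_toPlace_uniformizer_of_isUnramifiedIn L v hv w
  have hc : Valued.v (c w) = WithZero.exp (-1 : ℤ) := by rw [hcw]; exact hϖv
  obtain ⟨hc0, hc1, hcm, hcp, -, -⟩ := shift_parameter_facts hc
  have hc1' : ValuativeRel.valuation (w.1.adicCompletion L) (c w) < 1 := (v_lt_one_iff_valuation_lt_one _).1 hc1
  have h2val : ValuativeRel.valuation (w.1.adicCompletion L) (2 : w.1.adicCompletion L) = 1 := (v_eq_one_iff_valuation_eq_one _).1 h2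
  -- §1 regularity, matching of `y` with `u_H`, closed classes, compact centralisers, `K`
  obtain ⟨hD, hN⟩ := isUnit_det_shift_denominators_of_deep L w hw γH hc h2 hdeep
  have hιu := coe_endoEmbLocal_eq_moebius L v γH uH c h1 h2' hD1 hD2
  have hyu : IsLocalNormPair L H' v uH y := isLocalNormPair_of_coe_eq_moebius L v H' γH uH x y c hx hιu hy hD
  have hxreg : IsRegularElt (x.val : GL (Fin 3) (UnitaryGroup.LocalRing L v)) := isRegularElt_of_isLocalNormPair L H' v hx hreg
  have hyreg : IsRegularElt (y.val : GL (Fin 3) (UnitaryGroup.LocalRing L v)) := isRegularElt_of_isLocalNormPair L H' v hyu hreg'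
  have hP : ∀ g₀ z : (cmDatum L 3 H').Local v, IsRegularElt (g₀.val : GL (Fin 3) (UnitaryGroup.LocalRing L v)) →
      IsRegularElt ((z * g₀ * z⁻¹).val : GL (Fin 3) (UnitaryGroup.LocalRing L v)) := fun g₀ z hg₀ => isRegularElt_val_conj L 3 H' v g₀ z hg₀
  have hOx := isClosed_conjClass_local_of_isRegularElt L 3 H' v hH' hdet x hxreg
  have hOy := isClosed_conjClass_local_of_isRegularElt L 3 H' v hH' hdet y hyreg
  haveI := hZ x hx
  obtain ⟨hDx, -⟩ := isUnit_det_shift_denominators_of_isLocalNormPair L v H' c γH hD hN hx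
  haveI : CompactSpace (Subgroup.centralizer ({y} : Set ((cmDatum L 3 H').Local v))) := by
    rw [centralizer_eq_of_coe_eq_moebius L H' x y (isUnit_sq_sub_sq_of_apply_eq_toPlace_uniformizer L w hw hcw) hDx hy]
    exact hZ x hx
  obtain ⟨hKc, hKo⟩ := isCompact_isOpen_cmLocalIntegralLevel L 3 H' v
  -- §2 the integrands: `g_int = 1_{≡1}·g` and `g′`
  have hgc : Continuous g := hg.1.continuous
  have hg'c : Continuous g' := hg'.1.continuous
  set S₁ : Set ((cmDatum L 3 H').Local v) := {x : (cmDatum L 3 H').Local v | (∀ a b, Valued.v (((toPlace v w (HeckeCharacter.uniformizer ↥(maximalRealSubfield L) v : v.adicCompletion ↥(maximalRealSubfield L))) ^ 1)⁻¹ *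
          ((((localNonsplitEquiv (IsCMField.complexConj L) H' (IsCMField.complexConj_ne_one L) w hw x :
        ↥(unitaryGroupOfForm (galAdicCompletionMap (L := L) (IsCMField.complexConj L) hw) (placeForm H' w.1))) : GL (Fin 3) (w.1.adicCompletion L)) :
          Matrix (Fin 3) (Fin 3) (w.1.adicCompletion L)) a b - (1 : Matrix (Fin 3) (Fin 3) (w.1.adicCompletion L)) a b)) ≤ 1)} with hS₁
  have hS₁' : S₁ = {U : (cmDatum L 3 H').Local v | IsIntMatrix ((c w)⁻¹ • ((((localNonsplitEquiv (IsCMField.complexConj L) H' (IsCMField.complexConj_ne_one L) w hw U :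
        ↥(unitaryGroupOfForm (galAdicCompletionMap (L := L) (IsCMField.complexConj L) hw) (placeForm H' w.1))) : GL (Fin 3) (w.1.adicCompletion L)) :
          Matrix (Fin 3) (Fin 3) (w.1.adicCompletion L)) - 1))} := by
    ext U
    simp only [hS₁, Set.mem_setOf_eq, IsIntMatrix, Matrix.smul_apply, Matrix.sub_apply, smul_eq_mul, pow_one, hcw]
    exact Iff.rfl
  have hS₁o : IsOpen S₁ := by
    rw [hS₁']
    have h := isOpen_setOf_level L 3 H' (IsCMField.complexConj_ne_one L) w hw hc0 1
    simp only [pow_one] at h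
    exact h
  have hS₁cl : IsClosed S₁ := by rw [hS₁']; exact isClosed_setOf_levelOne L H' w hw hc0
  have hgint_c : Continuous (S₁.indicator g) := by
    rw [← Set.piecewise_eq_indicator]
    refine continuous_piecewise (fun a ha => ?_) hgc.continuousOn continuousOn_const
    rw [(IsClopen.frontier_eq ⟨hS₁cl, hS₁o⟩)] at ha
    exact absurd ha (Set.notMem_empty a)
  have hgint_supp : Function.support (S₁.indicator g) ⊆ (cmLocalIntegralLevel L 3 H' v : Set ((cmDatum L 3 H').Local v)) := by
    rw [Set.support_indicator]
    exact Set.inter_subset_right.trans ((subset_tsupport g).trans hgK)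
  have hg'supp : Function.support g' ⊆ (cmLocalIntegralLevel L 3 H' v : Set ((cmDatum L 3 H').Local v)) := (subset_tsupport g').trans hg'K
  have hgint_inv : ∀ k ∈ cmLocalIntegralLevel L 3 H' v, ∀ z : (cmDatum L 3 H').Local v, (S₁.indicator g) (k * z * k⁻¹) = (S₁.indicator g) z := by
    intro k hk z
    have hmem : k * z * k⁻¹ ∈ S₁ ↔ z ∈ S₁ := by
      rw [hS₁']
      exact isIntMatrix_inv_smul_conj_sub_one_iff L H' w hw (c w) hk z
    by_cases hz : z ∈ S₁
    · rw [Set.indicator_of_mem (hmem.2 hz), Set.indicator_of_mem hz, hginv k hk z]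
    · rw [Set.indicator_of_notMem (fun h => hz (hmem.1 h)), Set.indicator_of_notMem hz]
  -- §3 unfold both class orbital integrals over the fixed points on `G′ ⧸ K`
  rw [classOrbitalIntegral_eq_sum_fixedBy_of_support_subset_of_conj_invariant hP hmG hxreg (cmLocalIntegralLevel L 3 H' v) hKo hKc hOx
      (S₁.indicator g) hgint_c hgint_supp hgint_inv,
    classOrbitalIntegral_eq_sum_fixedBy_of_support_subset_of_conj_invariant hP hmG hyreg (cmLocalIntegralLevel L 3 H' v) hKo hKc hOy
      g' hg'c hg'supp hg'inv]
  congr 1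
  -- §4 the order memberships (★ N2′) and the fixed points of `y` = the interior fixed points of `x` (★ p846407)
  obtain ⟨hu, hu', hX⟩ := shifted_order_memberships_of_deep L H' w hw γH x y hc h2 hdeep hx hy
  have hu'' : (((((localNonsplitEquiv (IsCMField.complexConj L) H' (IsCMField.complexConj_ne_one L) w hw y :
        ↥(unitaryGroupOfForm (galAdicCompletionMap (L := L) (IsCMField.complexConj L) hw) (placeForm H' w.1))) : GL (Fin 3) (w.1.adicCompletion L)))⁻¹ : GL (Fin 3) (w.1.adicCompletion L)) : Matrix (Fin 3) (Fin 3) (w.1.adicCompletion L)) ∈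
      Algebra.adjoin 𝒪[w.1.adicCompletion L] ({1 + (c w)⁻¹ • ((((localNonsplitEquiv (IsCMField.complexConj L) H' (IsCMField.complexConj_ne_one L) w hw x :
        ↥(unitaryGroupOfForm (galAdicCompletionMap (L := L) (IsCMField.complexConj L) hw) (placeForm H' w.1))) : GL (Fin 3) (w.1.adicCompletion L)) :
          Matrix (Fin 3) (Fin 3) (w.1.adicCompletion L)) - 1)} : Set (Matrix (Fin 3) (Fin 3) (w.1.adicCompletion L))) := by
    rw [Matrix.coe_units_inv]; exact hu'
  have step1 : ∑ᶠ q ∈ MulAction.fixedBy ((cmDatum L 3 H').Local v ⧸ cmLocalIntegralLevel L 3 H' v) x, (S₁.indicator g) (q.out⁻¹ * x * q.out) =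
      ∑ᶠ q ∈ {q : (cmDatum L 3 H').Local v ⧸ cmLocalIntegralLevel L 3 H' v |
        q ∈ MulAction.fixedBy ((cmDatum L 3 H').Local v ⧸ cmLocalIntegralLevel L 3 H' v) x ∧
        IsIntMatrix ((c w)⁻¹ • ((((localNonsplitEquiv (IsCMField.complexConj L) H' (IsCMField.complexConj_ne_one L) w hw (q.out⁻¹ * x * q.out) :
        ↥(unitaryGroupOfForm (galAdicCompletionMap (L := L) (IsCMField.complexConj L) hw) (placeForm H' w.1))) : GL (Fin 3) (w.1.adicCompletion L)) :
          Matrix (Fin 3) (Fin 3) (w.1.adicCompletion L)) - 1))}, g (q.out⁻¹ * x * q.out) := by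
    rw [finsum_mem_def, finsum_mem_def]
    refine finsum_congr fun q => ?_
    simp only [Set.indicator_apply, Set.mem_setOf_eq]
    by_cases hq : q ∈ MulAction.fixedBy ((cmDatum L 3 H').Local v ⧸ cmLocalIntegralLevel L 3 H' v) x
    · by_cases hint : q.out⁻¹ * x * q.out ∈ S₁
      · have hint' := hint
        rw [hS₁', Set.mem_setOf_eq] at hint'
        rw [if_pos hq, if_pos hint, if_pos ⟨hq, hint'⟩]
      · have hint' := hint
        rw [hS₁', Set.mem_setOf_eq] at hint'
        rw [if_pos hq, if_neg hint, if_neg (fun h => hint' h.2)]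
    · rw [if_neg hq, if_neg (fun h => hq h.1)]
  rw [step1, sum_fixedBy_interior_eq_sum_fixedBy_cayley_relabel L 3 H' (IsCMField.complexConj_ne_one L) w hw hc0 hc1 x y hu hu'' hX
    (fun q => g (q.out⁻¹ * x * q.out))]
  -- §5 pointwise on the fixed points of `y`: `g(q⁻¹xq) = c′(rank Ā) = g′(q⁻¹yq)`
  refine finsum_mem_congr rfl fun q hq => ?_
  -- `k := q⁻¹yq ∈ K`, `z := q⁻¹xq ∈ K` with `z_w ≡ 1 (c_w)`
  have hk : q.out⁻¹ * y * q.out ∈ cmLocalIntegralLevel L 3 H' v := by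
    have h := (mem_fixedBy_quotient_mk_iff (cmLocalIntegralLevel L 3 H' v) y q.out).1
    rw [QuotientGroup.out_eq'] at h
    exact h hq
  obtain ⟨hzK, hzint⟩ := (conj_mem_and_interior_iff_conj_mem L 3 H' (IsCMField.complexConj_ne_one L) w hw hc0 hc1 x y hu hu'' hX q.out).1 hk
  -- names: `z = q⁻¹xq`, `k = q⁻¹yq`, their matrices at `w`, `A = c_w⁻¹(z_w − 1)`, `W = c_w⁻¹(ι_w − 1)`
  have hzw : (((localNonsplitEquiv (IsCMField.complexConj L) H' (IsCMField.complexConj_ne_one L) w hw (q.out⁻¹ * x * q.out) :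
        ↥(unitaryGroupOfForm (galAdicCompletionMap (L := L) (IsCMField.complexConj L) hw) (placeForm H' w.1))) : GL (Fin 3) (w.1.adicCompletion L)) :
          Matrix (Fin 3) (Fin 3) (w.1.adicCompletion L)) = (((q.out⁻¹ * x * q.out).val : GL (Fin 3) (UnitaryGroup.LocalRing L v)).val.map (Pi.evalRingHom (fun w' : UnitaryGroup.PlacesOver L v => w'.1.adicCompletion L) w)) := rfl
  have hkw : (((localNonsplitEquiv (IsCMField.complexConj L) H' (IsCMField.complexConj_ne_one L) w hw (q.out⁻¹ * y * q.out) :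
        ↥(unitaryGroupOfForm (galAdicCompletionMap (L := L) (IsCMField.complexConj L) hw) (placeForm H' w.1))) : GL (Fin 3) (w.1.adicCompletion L)) :
          Matrix (Fin 3) (Fin 3) (w.1.adicCompletion L)) = (((q.out⁻¹ * y * q.out).val : GL (Fin 3) (UnitaryGroup.LocalRing L v)).val.map (Pi.evalRingHom (fun w' : UnitaryGroup.PlacesOver L v => w'.1.adicCompletion L) w)) := rfl
  have hAint : IsIntMatrix ((c w)⁻¹ • ((((q.out⁻¹ * x * q.out).val : GL (Fin 3) (UnitaryGroup.LocalRing L v)).val.map (Pi.evalRingHom (fun w' : UnitaryGroup.PlacesOver L v => w'.1.adicCompletion L) w)) - 1)) := by rw [← hzw]; exact hzint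
  have hAvb : ValBound 1 ((c w)⁻¹ • ((((q.out⁻¹ * x * q.out).val : GL (Fin 3) (UnitaryGroup.LocalRing L v)).val.map (Pi.evalRingHom (fun w' : UnitaryGroup.PlacesOver L v => w'.1.adicCompletion L) w)) - 1)) := fun i j => (v_le_one_iff_valuation_le_one _).1 (hAint i j)
  -- (b) `z` matches `γ_H`: `z_w = P ι_w P⁻¹`, so `A = P W P⁻¹` and `charpoly A = charpoly W`
  have hz : IsLocalNormPair L H' v γH (q.out⁻¹ * x * q.out) :=
    isLocalNormPair_of_isConj L v H' γH hx (isConj_iff.2 ⟨q.out⁻¹, by rw [inv_inv]⟩)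
  obtain ⟨R, hR⟩ := isConj_iff.1 hz
  have hRdet : IsUnit (((R : GL (Fin 3) (LocalRing L v)) : Matrix (Fin 3) (Fin 3) (LocalRing L v)).map (Pi.evalRingHom (fun w' : UnitaryGroup.PlacesOver L v => w'.1.adicCompletion L) w)).det := by
    rw [← RingHom.mapMatrix_apply, ← RingHom.map_det]; exact (Matrix.isUnits_det_units R).map _
  set P : GL (Fin 3) (w.1.adicCompletion L) := Matrix.nonsingInvUnit _ hRdet with hP
  have hPv : (P : Matrix (Fin 3) (Fin 3) (w.1.adicCompletion L)) = ((R : GL (Fin 3) (LocalRing L v)) : Matrix (Fin 3) (Fin 3) (LocalRing L v)).map (Pi.evalRingHom (fun w' : UnitaryGroup.PlacesOver L v => w'.1.adicCompletion L) w) := rfl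
  have hPi : ((P⁻¹ : GL (Fin 3) (w.1.adicCompletion L)) : Matrix (Fin 3) (Fin 3) (w.1.adicCompletion L)) = ((((R : GL (Fin 3) (LocalRing L v)) : Matrix (Fin 3) (Fin 3) (LocalRing L v)).map (Pi.evalRingHom (fun w' : UnitaryGroup.PlacesOver L v => w'.1.adicCompletion L) w)))⁻¹ := by
    rw [Matrix.coe_units_inv, hPv]
  have hmz : (((q.out⁻¹ * x * q.out).val : GL (Fin 3) (LocalRing L v)).val : Matrix (Fin 3) (Fin 3) (LocalRing L v)) =
      (R : GL (Fin 3) (LocalRing L v)).val * ((((endoEmbLocal L v γH).val : GL (Fin 3) (LocalRing L v)).val : Matrix (Fin 3) (Fin 3) (LocalRing L v))) * (R⁻¹ : GL (Fin 3) (LocalRing L v)).val := by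
    rw [← hR, Units.val_mul, Units.val_mul]; rfl
  have hzconj : (((q.out⁻¹ * x * q.out).val : GL (Fin 3) (UnitaryGroup.LocalRing L v)).val.map (Pi.evalRingHom (fun w' : UnitaryGroup.PlacesOver L v => w'.1.adicCompletion L) w)) = (P : Matrix (Fin 3) (Fin 3) (w.1.adicCompletion L)) * (((endoEmbLocal L v γH).val : GL (Fin 3) (LocalRing L v)).val.map (Pi.evalRingHom (fun w' : UnitaryGroup.PlacesOver L v => w'.1.adicCompletion L) w)) * ((P⁻¹ : GL (Fin 3) (w.1.adicCompletion L)) : Matrix (Fin 3) (Fin 3) (w.1.adicCompletion L)) := by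
    rw [show (((q.out⁻¹ * x * q.out).val : GL (Fin 3) (UnitaryGroup.LocalRing L v)).val.map (Pi.evalRingHom (fun w' : UnitaryGroup.PlacesOver L v => w'.1.adicCompletion L) w)) = ((((q.out⁻¹ * x * q.out).val : GL (Fin 3) (LocalRing L v)).val : Matrix (Fin 3) (Fin 3) (LocalRing L v))).map (Pi.evalRingHom (fun w' : UnitaryGroup.PlacesOver L v => w'.1.adicCompletion L) w) from rfl, hmz, Matrix.map_mul, Matrix.map_mul, Matrix.coe_units_inv,
      map_nonsing_inv_of_isUnit _ _ (Matrix.isUnits_det_units R), hPi, hPv]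
  have hAconj : ((c w)⁻¹ • ((((q.out⁻¹ * x * q.out).val : GL (Fin 3) (UnitaryGroup.LocalRing L v)).val.map (Pi.evalRingHom (fun w' : UnitaryGroup.PlacesOver L v => w'.1.adicCompletion L) w)) - 1)) = (P : Matrix (Fin 3) (Fin 3) (w.1.adicCompletion L)) * ((c w)⁻¹ • ((((endoEmbLocal L v γH).val : GL (Fin 3) (LocalRing L v)).val.map (Pi.evalRingHom (fun w' : UnitaryGroup.PlacesOver L v => w'.1.adicCompletion L) w)) - 1)) * ((P⁻¹ : GL (Fin 3) (w.1.adicCompletion L)) : Matrix (Fin 3) (Fin 3) (w.1.adicCompletion L)) := by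
    have h1 := smul_units_conj_add_smul_one P (((endoEmbLocal L v γH).val : GL (Fin 3) (LocalRing L v)).val.map (Pi.evalRingHom (fun w' : UnitaryGroup.PlacesOver L v => w'.1.adicCompletion L) w)) (c w)⁻¹ (-(c w)⁻¹)
    rw [← hzconj] at h1
    have e1 : (c w)⁻¹ • (((q.out⁻¹ * x * q.out).val : GL (Fin 3) (UnitaryGroup.LocalRing L v)).val.map (Pi.evalRingHom (fun w' : UnitaryGroup.PlacesOver L v => w'.1.adicCompletion L) w)) + (-(c w)⁻¹) • (1 : Matrix (Fin 3) (Fin 3) (w.1.adicCompletion L)) = ((c w)⁻¹ • ((((q.out⁻¹ * x * q.out).val : GL (Fin 3) (UnitaryGroup.LocalRing L v)).val.map (Pi.evalRingHom (fun w' : UnitaryGroup.PlacesOver L v => w'.1.adicCompletion L) w)) - 1)) := by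
      rw [smul_sub, neg_smul, sub_eq_add_neg]
    have e2 : (c w)⁻¹ • (((endoEmbLocal L v γH).val : GL (Fin 3) (LocalRing L v)).val.map (Pi.evalRingHom (fun w' : UnitaryGroup.PlacesOver L v => w'.1.adicCompletion L) w)) + (-(c w)⁻¹) • (1 : Matrix (Fin 3) (Fin 3) (w.1.adicCompletion L)) = ((c w)⁻¹ • ((((endoEmbLocal L v γH).val : GL (Fin 3) (LocalRing L v)).val.map (Pi.evalRingHom (fun w' : UnitaryGroup.PlacesOver L v => w'.1.adicCompletion L) w)) - 1)) := by
      rw [smul_sub, neg_smul, sub_eq_add_neg]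
    rw [← e1, ← e2]; exact h1
  have hchar : (((c w)⁻¹ • ((((q.out⁻¹ * x * q.out).val : GL (Fin 3) (UnitaryGroup.LocalRing L v)).val.map (Pi.evalRingHom (fun w' : UnitaryGroup.PlacesOver L v => w'.1.adicCompletion L) w)) - 1))).charpoly = (((c w)⁻¹ • ((((endoEmbLocal L v γH).val : GL (Fin 3) (LocalRing L v)).val.map (Pi.evalRingHom (fun w' : UnitaryGroup.PlacesOver L v => w'.1.adicCompletion L) w)) - 1))).charpoly := by
    rw [hAconj, Matrix.coe_units_inv]; exact Matrix.charpoly_units_conj P _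
  -- (c) `W` is integral with entries of valuation `< 1` (2-deepness)
  have hWc : ∀ i j, Valued.v ((((c w)⁻¹ • ((((endoEmbLocal L v γH).val : GL (Fin 3) (LocalRing L v)).val.map (Pi.evalRingHom (fun w' : UnitaryGroup.PlacesOver L v => w'.1.adicCompletion L) w)) - 1))) i j) ≤ Valued.v (c w) := by
    intro i j
    rw [Matrix.smul_apply, smul_eq_mul, map_mul, map_inv₀]
    have hvc0 : Valued.v (c w) ≠ 0 := (Valuation.ne_zero_iff _).2 hc0
    calc (Valued.v (c w))⁻¹ * Valued.v (((((endoEmbLocal L v γH).val : GL (Fin 3) (LocalRing L v)).val.map (Pi.evalRingHom (fun w' : UnitaryGroup.PlacesOver L v => w'.1.adicCompletion L) w)) - 1) i j)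
        ≤ (Valued.v (c w))⁻¹ * Valued.v (c w) ^ 2 := mul_le_mul_right (hdeep i j) _
      _ = Valued.v (c w) := by rw [sq, ← mul_assoc, inv_mul_cancel₀ hvc0, one_mul]
  have hWvb : ValBound 1 ((c w)⁻¹ • ((((endoEmbLocal L v γH).val : GL (Fin 3) (LocalRing L v)).val.map (Pi.evalRingHom (fun w' : UnitaryGroup.PlacesOver L v => w'.1.adicCompletion L) w)) - 1)) := fun i j => (v_le_one_iff_valuation_le_one _).1 ((hWc i j).trans hc1.le)
  have hWlt : ∀ i j, ValuativeRel.valuation (w.1.adicCompletion L) ((((c w)⁻¹ • ((((endoEmbLocal L v γH).val : GL (Fin 3) (LocalRing L v)).val.map (Pi.evalRingHom (fun w' : UnitaryGroup.PlacesOver L v => w'.1.adicCompletion L) w)) - 1))) i j) < 1 := fun i j => (v_lt_one_iff_valuation_lt_one _).1 ((hWc i j).trans_lt hc1)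
  -- (d) the residual nilpotent `Ā` of `z` is cube-zero, of rank `< 3`
  have hA3 : redMat ((c w)⁻¹ • ((((q.out⁻¹ * x * q.out).val : GL (Fin 3) (UnitaryGroup.LocalRing L v)).val.map (Pi.evalRingHom (fun w' : UnitaryGroup.PlacesOver L v => w'.1.adicCompletion L) w)) - 1)) ^ 3 = 0 := pow_card_redMat_eq_zero_of_charpoly_eq hAvb hWvb hWlt hchar
  have hrk : (redMat ((c w)⁻¹ • ((((q.out⁻¹ * x * q.out).val : GL (Fin 3) (UnitaryGroup.LocalRing L v)).val.map (Pi.evalRingHom (fun w' : UnitaryGroup.PlacesOver L v => w'.1.adicCompletion L) w)) - 1))).rank < 3 := rank_lt_of_pow_eq_zero hA3 (by norm_num)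
  -- (e) `k_w = φ_{c_w}(z_w)`: on `E_v`, then at `w`, then in terms of `A`
  obtain ⟨hDx, -⟩ := isUnit_det_shift_denominators_of_isLocalNormPair L v H' c γH hD hN hx
  obtain ⟨hDz, -⟩ := isUnit_det_shift_denominators_of_isLocalNormPair L v H' c γH hD hN hz
  have hQdet : IsUnit ((((q.out⁻¹ : (cmDatum L 3 H').Local v).val : GL (Fin 3) (LocalRing L v)).val : Matrix (Fin 3) (Fin 3) (LocalRing L v))).det := Matrix.isUnits_det_units _
  have hQinv : ((((q.out⁻¹ : (cmDatum L 3 H').Local v).val : GL (Fin 3) (LocalRing L v)).val : Matrix (Fin 3) (Fin 3) (LocalRing L v)))⁻¹ = ((q.out.val : GL (Fin 3) (LocalRing L v)).val : Matrix (Fin 3) (Fin 3) (LocalRing L v)) :=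
    Matrix.inv_eq_right_inv (Units.inv_mul ((q.out : (cmDatum L 3 H').Local v).val : GL (Fin 3) (LocalRing L v)))
  have hzmat : (((q.out⁻¹ * x * q.out).val : GL (Fin 3) (LocalRing L v)).val : Matrix (Fin 3) (Fin 3) (LocalRing L v)) = (((q.out⁻¹ : (cmDatum L 3 H').Local v).val : GL (Fin 3) (LocalRing L v)).val : Matrix (Fin 3) (Fin 3) (LocalRing L v)) * ((x.val : GL (Fin 3) (LocalRing L v)).val : Matrix (Fin 3) (Fin 3) (LocalRing L v)) * ((((q.out⁻¹ : (cmDatum L 3 H').Local v).val : GL (Fin 3) (LocalRing L v)).val : Matrix (Fin 3) (Fin 3) (LocalRing L v)))⁻¹ := by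
    rw [hQinv]; rfl
  have hkmat : (((q.out⁻¹ * y * q.out).val : GL (Fin 3) (LocalRing L v)).val : Matrix (Fin 3) (Fin 3) (LocalRing L v)) =
      ((c + 1) • (((q.out⁻¹ * x * q.out).val : GL (Fin 3) (LocalRing L v)).val : Matrix (Fin 3) (Fin 3) (LocalRing L v)) + (c - 1) • 1) * ((c - 1) • (((q.out⁻¹ * x * q.out).val : GL (Fin 3) (LocalRing L v)).val : Matrix (Fin 3) (Fin 3) (LocalRing L v)) + (c + 1) • 1)⁻¹ := by
    have e1 : (((q.out⁻¹ * y * q.out).val : GL (Fin 3) (LocalRing L v)).val : Matrix (Fin 3) (Fin 3) (LocalRing L v)) = (((q.out⁻¹ : (cmDatum L 3 H').Local v).val : GL (Fin 3) (LocalRing L v)).val : Matrix (Fin 3) (Fin 3) (LocalRing L v)) * ((y.val : GL (Fin 3) (LocalRing L v)).val : Matrix (Fin 3) (Fin 3) (LocalRing L v)) * ((((q.out⁻¹ : (cmDatum L 3 H').Local v).val : GL (Fin 3) (LocalRing L v)).val : Matrix (Fin 3) (Fin 3) (LocalRing L v)))⁻¹ := by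
      rw [hQinv]; rfl
    rw [e1, hy, ← moebius_conj _ _ hQdet _ _ hDx, ← hzmat]
  have hkw' : (((q.out⁻¹ * y * q.out).val : GL (Fin 3) (UnitaryGroup.LocalRing L v)).val.map (Pi.evalRingHom (fun w' : UnitaryGroup.PlacesOver L v => w'.1.adicCompletion L) w)) =
      (((c w) + 1) • (((q.out⁻¹ * x * q.out).val : GL (Fin 3) (UnitaryGroup.LocalRing L v)).val.map (Pi.evalRingHom (fun w' : UnitaryGroup.PlacesOver L v => w'.1.adicCompletion L) w)) + ((c w) - 1) • (1 : Matrix (Fin 3) (Fin 3) (w.1.adicCompletion L))) *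
        (((c w) - 1) • (((q.out⁻¹ * x * q.out).val : GL (Fin 3) (UnitaryGroup.LocalRing L v)).val.map (Pi.evalRingHom (fun w' : UnitaryGroup.PlacesOver L v => w'.1.adicCompletion L) w)) + ((c w) + 1) • (1 : Matrix (Fin 3) (Fin 3) (w.1.adicCompletion L)))⁻¹ := by
    rw [show (((q.out⁻¹ * y * q.out).val : GL (Fin 3) (UnitaryGroup.LocalRing L v)).val.map (Pi.evalRingHom (fun w' : UnitaryGroup.PlacesOver L v => w'.1.adicCompletion L) w)) = ((((q.out⁻¹ * y * q.out).val : GL (Fin 3) (LocalRing L v)).val : Matrix (Fin 3) (Fin 3) (LocalRing L v))).map (Pi.evalRingHom (fun w' : UnitaryGroup.PlacesOver L v => w'.1.adicCompletion L) w) from rfl, hkmat, map_moebius _ _ _ _ hDz, map_add, map_sub, map_one]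
    rfl
  have hcm1 : ValuativeRel.valuation (w.1.adicCompletion L) (c w - 1) ≤ 1 := (v_le_one_iff_valuation_le_one _).1 hcm.le
  have hNu : IsUnit ((2 : (w.1.adicCompletion L)) • (1 : Matrix (Fin 3) (Fin 3) (w.1.adicCompletion L)) + (c w - 1) • ((c w)⁻¹ • ((((q.out⁻¹ * x * q.out).val : GL (Fin 3) (UnitaryGroup.LocalRing L v)).val.map (Pi.evalRingHom (fun w' : UnitaryGroup.PlacesOver L v => w'.1.adicCompletion L) w)) - 1))).det := by
    have h := valuation_det_two_smul_one_add_smul_eq_one hAvb ⟨3, hA3⟩ hcm1 h2val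
    exact isUnit_iff_ne_zero.2 fun h0 => by rw [h0, map_zero] at h; exact zero_ne_one h
  have hzA : (((q.out⁻¹ * x * q.out).val : GL (Fin 3) (UnitaryGroup.LocalRing L v)).val.map (Pi.evalRingHom (fun w' : UnitaryGroup.PlacesOver L v => w'.1.adicCompletion L) w)) = 1 + (c w) • ((c w)⁻¹ • ((((q.out⁻¹ * x * q.out).val : GL (Fin 3) (UnitaryGroup.LocalRing L v)).val.map (Pi.evalRingHom (fun w' : UnitaryGroup.PlacesOver L v => w'.1.adicCompletion L) w)) - 1)) := eq_one_add_smul_inv_smul_sub_one hc0 _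
  have hMB : (((q.out⁻¹ * y * q.out).val : GL (Fin 3) (UnitaryGroup.LocalRing L v)).val.map (Pi.evalRingHom (fun w' : UnitaryGroup.PlacesOver L v => w'.1.adicCompletion L) w)) * ((2 : (w.1.adicCompletion L)) • (1 : Matrix (Fin 3) (Fin 3) (w.1.adicCompletion L)) + (c w - 1) • ((c w)⁻¹ • ((((q.out⁻¹ * x * q.out).val : GL (Fin 3) (UnitaryGroup.LocalRing L v)).val.map (Pi.evalRingHom (fun w' : UnitaryGroup.PlacesOver L v => w'.1.adicCompletion L) w)) - 1))) =
      (2 : (w.1.adicCompletion L)) • (1 : Matrix (Fin 3) (Fin 3) (w.1.adicCompletion L)) + (c w + 1) • ((c w)⁻¹ • ((((q.out⁻¹ * x * q.out).val : GL (Fin 3) (UnitaryGroup.LocalRing L v)).val.map (Pi.evalRingHom (fun w' : UnitaryGroup.PlacesOver L v => w'.1.adicCompletion L) w)) - 1)) := by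
    have h := moebius_one_add_smul_eq ((c w)⁻¹ • ((((q.out⁻¹ * x * q.out).val : GL (Fin 3) (UnitaryGroup.LocalRing L v)).val.map (Pi.evalRingHom (fun w' : UnitaryGroup.PlacesOver L v => w'.1.adicCompletion L) w)) - 1)) hc0 hNu
    rw [← hzA] at h
    rw [hkw', h, Matrix.nonsing_inv_mul_cancel_right _ _ hNu]
  -- (f) the residual class of `k`: nilpotent of the same rank
  have hkvb : ValBound 1 (((q.out⁻¹ * y * q.out).val : GL (Fin 3) (UnitaryGroup.LocalRing L v)).val.map (Pi.evalRingHom (fun w' : UnitaryGroup.PlacesOver L v => w'.1.adicCompletion L) w)) := by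
    have h := ((mem_cmLocalIntegralLevel_iff_isIntMatrix L 3 H' (IsCMField.complexConj_ne_one L) w hw _).1 hk).1
    rw [hkw] at h
    exact fun i j => (v_le_one_iff_valuation_le_one _).1 (h i j)
  have hk3 : (redMat (((q.out⁻¹ * y * q.out).val : GL (Fin 3) (UnitaryGroup.LocalRing L v)).val.map (Pi.evalRingHom (fun w' : UnitaryGroup.PlacesOver L v => w'.1.adicCompletion L) w)) - 1) ^ 3 = 0 := pow_redMat_sub_one_eq_zero_of_shift hkvb hAvb hA3 hc1' h2val hMB
  have hrank : (redMat (((q.out⁻¹ * y * q.out).val : GL (Fin 3) (UnitaryGroup.LocalRing L v)).val.map (Pi.evalRingHom (fun w' : UnitaryGroup.PlacesOver L v => w'.1.adicCompletion L) w)) - 1).rank = (redMat ((c w)⁻¹ • ((((q.out⁻¹ * x * q.out).val : GL (Fin 3) (UnitaryGroup.LocalRing L v)).val.map (Pi.evalRingHom (fun w' : UnitaryGroup.PlacesOver L v => w'.1.adicCompletion L) w)) - 1))).rank :=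
    rank_redMat_sub_one_eq_of_shift hkvb hAvb ⟨3, hA3⟩ hc1' h2val hMB
  -- (g) the values
  have hg'k : g' (q.out⁻¹ * y * q.out) = c' (redMat (((q.out⁻¹ * y * q.out).val : GL (Fin 3) (UnitaryGroup.LocalRing L v)).val.map (Pi.evalRingHom (fun w' : UnitaryGroup.PlacesOver L v => w'.1.adicCompletion L) w)) - 1).rank := hg'val _ hk hk3
  have hlev : ∀ a b, Valued.v ((ϖ' ^ 1)⁻¹ * ((((localNonsplitEquiv (IsCMField.complexConj L) H' (IsCMField.complexConj_ne_one L) w hw (q.out⁻¹ * x * q.out) :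
        ↥(unitaryGroupOfForm (galAdicCompletionMap (L := L) (IsCMField.complexConj L) hw) (placeForm H' w.1))) : GL (Fin 3) (w.1.adicCompletion L)) :
          Matrix (Fin 3) (Fin 3) (w.1.adicCompletion L)) a b - (1 : Matrix (Fin 3) (Fin 3) (w.1.adicCompletion L)) a b)) ≤ 1 := by
    intro a b
    have h := hzint a b
    rw [Matrix.smul_apply, Matrix.sub_apply, smul_eq_mul, hcw] at h
    rwa [pow_one]
  have hA3' : redMat (ϖ'⁻¹ • ((((q.out⁻¹ * x * q.out).val : GL (Fin 3) (UnitaryGroup.LocalRing L v)).val.map (Pi.evalRingHom (fun w' : UnitaryGroup.PlacesOver L v => w'.1.adicCompletion L) w)) - 1)) ^ 3 = 0 := by rw [← hcw]; exact hA3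
  have hgz : g (q.out⁻¹ * x * q.out) = c' (redMat (ϖ'⁻¹ • ((((q.out⁻¹ * x * q.out).val : GL (Fin 3) (UnitaryGroup.LocalRing L v)).val.map (Pi.evalRingHom (fun w' : UnitaryGroup.PlacesOver L v => w'.1.adicCompletion L) w)) - 1))).rank := by
    obtain ⟨h0, h1c, h2c⟩ := hc'
    have hrk' : (redMat (ϖ'⁻¹ • ((((q.out⁻¹ * x * q.out).val : GL (Fin 3) (UnitaryGroup.LocalRing L v)).val.map (Pi.evalRingHom (fun w' : UnitaryGroup.PlacesOver L v => w'.1.adicCompletion L) w)) - 1))).rank < 3 := by rw [← hcw]; exact hrk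
    generalize hr : (redMat (ϖ'⁻¹ • ((((q.out⁻¹ * x * q.out).val : GL (Fin 3) (UnitaryGroup.LocalRing L v)).val.map (Pi.evalRingHom (fun w' : UnitaryGroup.PlacesOver L v => w'.1.adicCompletion L) w)) - 1))).rank = r at hrk' ⊢
    interval_cases r
    · exact h0 _ ⟨hzK, hlev, hA3', hr⟩
    · exact h1c _ ⟨hzK, hlev, hA3', hr⟩
    · exact h2c _ ⟨hzK, hlev, hA3', hr⟩
  rw [hgz, hg'k, hrank, hcw]


end Literature.NumberTheory.Automorphic

end
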